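import Summits.QuantumFields.BalabanUV.T4Continuum.Support.NE7MinimiserLipschitz
import HarnessLib

/-!
# NE7MinimiserLipschitzChart — THE LIPSCHITZ DEPENDENCE OF `U_k(V)` ON `V` IN THE CHART CURRENCY: over the small data, at every level `j+1` and base `(V₀, U♯)`: `∃ C ≥ 0`, EVENTUALLY as the
# unitary `N`-periodic datum `V → V₀`, every minimiser `U` over `V` has a stabiliser gauge copy `U^{u} = chart_{U♯}(Φ)` with `‖Φ‖ ≤ C·‖y(V)‖` (`y(V) = skewPR N (relLog N V₀ V)`) — the
# decoding (`NE7TorusChartDecoding`) of ✓ p822968 `NE7MinimiserLipschitz.minimiser_lipschitz`; the form in which the next rung (C¹ via a slice implicit function theorem in the chart at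
# `U♯`, ROAD-G114 §6) consumes the Lipschitz estimate

Cell `pub-balaban`, rung (B)+1 sub-cell t4, lineage `b2b-balaban-t4-ne7-p1` (CRUX PROVER NE7 #1 = OWNER of BINDER row NE7), generation 114.  Memo `t4/b2b-balaban-t4-ne7-p1-g114/ROAD-G114.md` §4.
WHAT ([folklore]; 0 def, 0 sorry; `d = 4`, every `U(n)`, every `L ≥ 2`).  **`minimiser_lipschitz_chart`**.
HONEST FRAMING (page 1): a corollary; `C` EXISTENTIAL, NOT uniform in `V₀`, `j`, `N`; Lipschitz only; nothing of Bałaban's asserted and NOT his method; NOT NE7 as a spine node, NOT NE3; spine 0∕9;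
NOT infinite volume, NOT mass gap, NOT BetaPertH, NOT Clay.
-/

set_option autoImplicit false

open scoped BigOperators Matrix Matrix.Norms.L2Operator Topology
open NormedSpace Finset Set Filter Metric

namespace Summit.QuantumFields.BalabanUV.T4Continuum.NE7MinimiserLipschitzChart

open Literature.MathematicalPhysics.QuantumFieldTheory.Balaban1983to89
open B7Prop1Explicit B7Prop2Explicit
open T4AveragingDeficitWall (IsUnitaryCfg SmallField)
open T4AveragingDeficitWallBoundary (IsPeriodicCfg)
open AveragingDeficitTorusChart (TDir chart)
open AveragingDeficitChartCalculus (relLog)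
open AveragingDeficitTwoLevelPrep (skewSub skewPR)
open AveragingDeficitMultiLevelPrep (tower)
open AveragingDeficitKDatum (isUnitaryCfg_gaugeAct)
open MinimalActionSandwich (IsMinimiser)
open MinimalActionRate (sfClass)
open NE3EnergyShapes (IsUnitarySite IsPeriodicSite)
open NE3ResidualSliceRep (isPeriodicCfg_gaugeAct)
open NE7AdmissibleFibreLHC (period_succ_eq tendsto_skewPR_relLog)
open NE7TorusChartDecoding (chart_skewPR_relLog_eq norm_skewPR_relLog_le)
open NE7MinimiserLipschitz (minimiser_lipschitz)

noncomputable section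

variable {n : Type} [Fintype n] [DecidableEq n]

/-- **`U_k(V)` IS LIPSCHITZ IN `V` MODULO GAUGE — CHART FORM.**  Over the small data, at every level `j+1` and base datum `V₀`: there is a minimiser `U♯` over `V₀` and `C ≥ 0` such that EVENTUALLY as
the unitary `N`-periodic datum `V → V₀`, every minimiser `U` over `V` admits a unitary `(N·L^{j+1})`-periodic gauge `u` with corner values fixing `V₀` and a chart parameter `Φ ∈ skewSub (L·tower L N j)`
with `U^{u} = chart_{U♯}(Φ)` and `‖Φ‖ ≤ C·‖skewPR N (relLog N V₀ V)‖`. [folklore] -/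
theorem minimiser_lipschitz_chart [Nonempty n] {L : ℕ} [NeZero L] (hL : 2 ≤ L) :
    ∃ ε₀ : ℝ, 0 < ε₀ ∧ ∀ ε : ℝ, 0 < ε → ε ≤ ε₀ → ∀ (N : ℕ) [NeZero N], 1 ≤ N →
      ∃ δV : ℝ, 0 < δV ∧
        ∀ V₀ ∈ {V : Site 4 → Fin 4 → (Matrix n n ℂ)ˣ | IsUnitaryCfg V ∧ IsPeriodicCfg V (N : ℤ) ∧ SmallField V δV},
        ∀ j : ℕ, ∃ Us : Site 4 → Fin 4 → (Matrix n n ℂ)ˣ, IsMinimiser 4 (sfClass 4 L N ε) L N (j + 1) V₀ Us ∧ ∃ C : ℝ, 0 ≤ C ∧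
          ∀ᶠ V in 𝓝 V₀, IsUnitaryCfg V → IsPeriodicCfg V (N : ℤ) →
            ∀ U : Site 4 → Fin 4 → (Matrix n n ℂ)ˣ, IsMinimiser 4 (sfClass 4 L N ε) L N (j + 1) V U →
              ∃ (u : Site 4 → (Matrix n n ℂ)ˣ) (Φ : ↥(skewSub 4 n (L * tower L N j))), IsUnitarySite u ∧ IsPeriodicSite u ((N * L ^ (j + 1) : ℕ) : ℤ) ∧
                (∀ (z : Site 4) (κ : Fin 4), (u (((L : ℤ) ^ (j + 1)) • z) : Matrix n n ℂ) * (V₀ z κ : Matrix n n ℂ)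
                  * (((u (((L : ℤ) ^ (j + 1)) • (z + e κ)))⁻¹ : (Matrix n n ℂ)ˣ) : Matrix n n ℂ) = V₀ z κ) ∧
                gaugeAct u U = chart (ContinuousLinearMap.id ℝ (Matrix n n ℂ)) (L * tower L N j) Us (Φ : TDir 4 n (L * tower L N j)) ∧
                ‖Φ‖ ≤ C * ‖skewPR N (relLog N V₀ V)‖ := by
  obtain ⟨ε₀, hε₀, H⟩ := minimiser_lipschitz (n := n) hL
  refine ⟨ε₀, hε₀, fun ε hε hεle N _ hN => ?_⟩
  obtain ⟨δV, hδV, H1⟩ := H ε hε hεle N hN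
  refine ⟨δV, hδV, fun V₀ hV₀ j => ?_⟩
  obtain ⟨Us, hUs, C, hC, hev⟩ := H1 V₀ hV₀ j
  set M : ℕ := L * tower L N j with hMdef
  have hper : N * L ^ (j + 1) = M := by rw [hMdef]; exact period_succ_eq L N j
  haveI : NeZero M := ⟨by rw [← hper]; exact Nat.mul_ne_zero (NeZero.ne N) (pow_ne_zero _ (by omega))⟩
  have hUsU : IsUnitaryCfg Us := hUs.mem.1.1
  have hUsP : IsPeriodicCfg Us (M : ℤ) := by have h := hUs.mem.1.2.1; rwa [hper] at h
  refine ⟨Us, hUs, 2 * C, by positivity, ?_⟩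
  -- eventually the datum coordinate is small enough for the decoding
  have hcoord : ∀ᶠ V in 𝓝 V₀, ‖skewPR N (relLog N V₀ V)‖ < 1 / (8 * (C + 1)) := by
    have h := tendsto_skewPR_relLog (d := 4) (n := n) N V₀
    have hb : Metric.ball (0 : ↥(skewSub 4 n N)) (1 / (8 * (C + 1))) ∈ 𝓝 (0 : ↥(skewSub 4 n N)) := Metric.ball_mem_nhds _ (by positivity)
    have h2 : ∀ᶠ V in 𝓝 V₀, skewPR N (relLog N V₀ V) ∈ Metric.ball (0 : ↥(skewSub 4 n N)) (1 / (8 * (C + 1))) := h hb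
    exact h2.mono fun V hV => by simpa [dist_zero_right] using hV
  filter_upwards [hev, hcoord] with V hV hVt hVu hVP U hU
  obtain ⟨u, hu, huP, hfix, hbond⟩ := hV hVu hVP U hU
  set t : ℝ := ‖skewPR N (relLog N V₀ V)‖ with ht
  have ht0 : 0 ≤ t := norm_nonneg _
  have hCt : C * t ≤ 1 / 8 := by
    have h1 : C * t ≤ (C + 1) * t := by nlinarith
    have h2 : (C + 1) * t ≤ (C + 1) * (1 / (8 * (C + 1))) := mul_le_mul_of_nonneg_left hVt.le (by positivity)
    have h3 : (C + 1) * (1 / (8 * (C + 1))) = 1 / 8 := by field_simp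
    linarith
  have hXu : IsUnitaryCfg (gaugeAct u U) := isUnitaryCfg_gaugeAct hu hU.mem.1.1
  have hXP : IsPeriodicCfg (gaugeAct u U) (M : ℤ) := by
    have h := isPeriodicCfg_gaugeAct huP hU.mem.1.2.1
    rwa [hper] at h
  have hnear : ∀ (r : Fin 4 → Fin M) (κ : Fin 4),
      ‖(((Us (boxVec M r) κ)⁻¹ : (Matrix n n ℂ)ˣ) : Matrix n n ℂ) * ((gaugeAct u U (boxVec M r) κ : (Matrix n n ℂ)ˣ) : Matrix n n ℂ) - 1‖ ≤ C * t := fun r κ => hbond r κ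
  refine ⟨u, skewPR M (relLog M Us (gaugeAct u U)), hu, huP, hfix, ?_, ?_⟩
  · exact (chart_skewPR_relLog_eq hUsU hXu hUsP hXP fun r κ => (hnear r κ).trans (by linarith)).symm
  · have h := norm_skewPR_relLog_le (by positivity) (by linarith) hnear
    linarith

end

end Summit.QuantumFields.BalabanUV.T4Continuum.NE7MinimiserLipschitzChart
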